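import Summits.QuantumAdvantage.QuantumAdvantage.Theorems.SosSandwichPseudoBoundedAAClassicalCornerSensitivityOSSSWeighted
import HarnessLib

/-!
# Crux `PseudoBoundedAA` (stmt-QuantumAdvantage-15237, route SosSandwich) — the GEOMETRIC-MEAN OSSS law on the classical
# corner: `4·Var[p] ≤ Σⱼ √(Īⱼ · δ̄ⱼ · Infⱼ[p])`

Support file (`--supports stmt-QuantumAdvantage-15237`), sequel of `…ClassicalCornerSensitivityOSSSWeighted.lean`
(`osss_wsens`: bilinear two-function OSSS with a weight `λⱼ` per coordinate).  Optimising each `λⱼ` separately: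

* `le_sum_sqrt_of_forall_pos` — if `v ≤ ⅛ Σⱼ (λⱼ aⱼ + bⱼ/λⱼ)` for all positive `λ`, then `v ≤ ¼ Σⱼ √(aⱼ bⱼ)`
  (`aⱼ, bⱼ ≥ 0`; degenerate coordinates handled with an `ε` of room);
* **`four_variance_le_sum_sqrt`** — for `p` on the cube a nonnegative mixture `p = Σ_k w_k [t_k accepts]` of decision trees:
  `4·Var[p] ≤ Σⱼ √(Īⱼ · δ̄ⱼ · Infⱼ[p])`, where `Īⱼ = Σ_k w_k·#{x : t_k(x^{j→1}) ≠ t_k(x^{j→0})}/2^N` is the mixture-averaged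
  influence of `j` on the TREES, `δ̄ⱼ = Σ_k w_k·#{x : j ∈ t_k.queries x}/2^N` the query probability and `Infⱼ[p]` the
  influence of `j` on the MIXTURE `p`.

Why this is the right common roof of the classical-corner laws in the tree: `Īⱼ ≤ δ̄ⱼ` (pivotal ⟹ queried,
`card_pivotal_le_card_queries`), so `√(Īⱼ δ̄ⱼ Infⱼ) ≤ δ̄ⱼ √Infⱼ` and the law implies the query-probability OSSS law
`4Var ≤ Σⱼ δ̄ⱼ √Infⱼ` (`ClassicalCornerQueryOSSS`); by Cauchy–Schwarz `(Σⱼ √(Īⱼ δ̄ⱼ Infⱼ))² ≤ (Σⱼ Īⱼ)(Σⱼ δ̄ⱼ Infⱼ)`, so it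
implies the sensitivity law `16Var² ≤ Ī·Σⱼ δ̄ⱼ Infⱼ` (`sixteen_variance_sq_le_avgSensitivity_mul`); and `Infⱼ[p] ≤ Īⱼ`
(Jensen: cancellation between trees only lowers the mixture's influence).  The conjectured `L²`-OSSS law with an ABSOLUTE
constant, `16Var² ≤ C₀ Σⱼ δ̄ⱼ Infⱼ`, remains open (numerics on the item: best constant `8/7` at depth 2, `≈ 1.16` at depth 3).

Honest label: corner calibration of an open conjecture; no registered stub, crux or summit is closed.
Sources: R. O'Donnell, M. Saks, O. Schramm, R. Servedio, FOCS 2005, Thm 3.2; R. O'Donnell, *Analysis of Boolean Functions*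
(2014) §8.6; S. Aaronson, A. Ambainis, arXiv:0911.0996, Thm 8 and the remark following it.
-/

set_option linter.dupNamespace false

noncomputable section

namespace Summit.QuantumAdvantage.QuantumAdvantage.Theorems.SosSandwich

open Finset Function
open Literature.Computability.Complexity Literature.Computability.QuantumComplexity

namespace ClassicalCornerSensitivityOSSS

variable {N : ℕ}

/-! ### Optimising a weight per coordinate -/

/-- For `s, t > 0`: `(t/s)·s² + t²/(t/s) = 2·s·t`. [folklore] -/
theorem weight_opt_identity {s t : ℝ} (hs : 0 < s) (ht : 0 < t) :
    t / s * s ^ 2 + t ^ 2 / (t / s) = 2 * (s * t) := by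
  field_simp
  ring

/-- **Optimising the weights.** If `v ≤ ⅛ Σⱼ (λⱼ aⱼ + bⱼ/λⱼ)` for every positive weight vector `λ` (`aⱼ, bⱼ ≥ 0`), then
`v ≤ ¼ Σⱼ √(aⱼ bⱼ)` (take `λⱼ = √bⱼ/√aⱼ`, with an `ε` of room on the coordinates where `aⱼ bⱼ = 0`). [folklore] -/
theorem le_sum_sqrt_of_forall_pos {v : ℝ} (a b : Fin N → ℝ) (ha : ∀ j, 0 ≤ a j) (hb : ∀ j, 0 ≤ b j)
    (h : ∀ lam : Fin N → ℝ, (∀ j, 0 < lam j) → v ≤ (∑ j, (lam j * a j + b j / lam j)) / 8) :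
    v ≤ (∑ j, Real.sqrt (a j * b j)) / 4 := by
  refine le_of_forall_pos_le_add fun ε hε => ?_
  set δ : ℝ := 8 * ε / ((N : ℝ) + 1) with hδ
  have hN1 : (0 : ℝ) < (N : ℝ) + 1 := by positivity
  have hδpos : 0 < δ := by positivity
  set lam : Fin N → ℝ := fun j =>
    if 0 < a j ∧ 0 < b j then Real.sqrt (b j) / Real.sqrt (a j)
    else if a j = 0 then (b j + 1) / δ else δ / a j with hlam
  have hterm : ∀ j, 0 < lam j ∧ lam j * a j + b j / lam j ≤ 2 * Real.sqrt (a j * b j) + δ := by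
    intro j
    by_cases hab : 0 < a j ∧ 0 < b j
    · have hl : lam j = Real.sqrt (b j) / Real.sqrt (a j) := by simp only [hlam, if_pos hab]
      have hsa : 0 < Real.sqrt (a j) := Real.sqrt_pos.mpr hab.1
      have hsb : 0 < Real.sqrt (b j) := Real.sqrt_pos.mpr hab.2
      refine ⟨by rw [hl]; positivity, ?_⟩
      have hid := weight_opt_identity hsa hsb
      rw [Real.sq_sqrt (ha j), Real.sq_sqrt (hb j)] at hid
      rw [hl, hid, Real.sqrt_mul (ha j), ← mul_assoc]
      linarith
    · by_cases ha0 : a j = 0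
      · have hl : lam j = (b j + 1) / δ := by simp only [hlam, if_neg hab, if_pos ha0]
        have hb1 : 0 < b j + 1 := by linarith [hb j]
        refine ⟨by rw [hl]; positivity, ?_⟩
        rw [hl, ha0, mul_zero, zero_add, zero_mul, Real.sqrt_zero, mul_zero, zero_add]
        rw [div_div_eq_mul_div, div_le_iff₀ hb1]
        nlinarith [hb j, hδpos]
      · have hapos : 0 < a j := lt_of_le_of_ne (ha j) (Ne.symm ha0)
        have hb0 : b j = 0 := by
          by_contra hbne
          exact hab ⟨hapos, lt_of_le_of_ne (hb j) (Ne.symm hbne)⟩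
        have hl : lam j = δ / a j := by simp only [hlam, if_neg hab, if_neg ha0]
        refine ⟨by rw [hl]; positivity, ?_⟩
        rw [hl, hb0, zero_div, add_zero, mul_zero, Real.sqrt_zero, mul_zero, zero_add,
          div_mul_cancel₀ _ (ne_of_gt hapos)]
  have hv := h lam fun j => (hterm j).1
  have hsum : ∑ j, (lam j * a j + b j / lam j) ≤ ∑ j, (2 * Real.sqrt (a j * b j) + δ) :=
    Finset.sum_le_sum fun j _ => (hterm j).2
  have hR : ∑ j, (2 * Real.sqrt (a j * b j) + δ) = 2 * (∑ j, Real.sqrt (a j * b j)) + (N : ℝ) * δ := by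
    rw [Finset.sum_add_distrib, Finset.sum_const, Finset.card_univ, Fintype.card_fin, nsmul_eq_mul,
      ← Finset.mul_sum]
  have hNδ : (N : ℝ) * δ ≤ 8 * ε := by
    rw [hδ, mul_div_assoc', div_le_iff₀ hN1]
    nlinarith [hε.le]
  linarith

/-! ### The geometric-mean law on the classical corner -/

/-- **The geometric-mean OSSS law on the classical corner.** If the real polynomial `p` is on the cube a nonnegative
mixture `p(x) = Σ_{k∈s} w_k·[t_k accepts x]` of decision trees, then
`4·Var[p] ≤ Σⱼ √(Īⱼ · δ̄ⱼ · Infⱼ[p])`, with `Īⱼ = Σ_k w_k·#{x : t_k.eval(x^{j→1}) ≠ t_k.eval(x^{j→0})}/2^N` the averaged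
influence of `j` on the trees and `δ̄ⱼ = Σ_k w_k·#{x : j ∈ t_k.queries x}/2^N` its query probability.  It implies the
tree's query-probability OSSS law (`Īⱼ ≤ δ̄ⱼ`) and the sensitivity law `16Var² ≤ Ī·Σⱼ δ̄ⱼ Infⱼ` (Cauchy–Schwarz).
[cite: OdonnellEtAl2005, Thm 3.2] [cite: AaronsonAmbainis2014, Thm 8 and the remark following it] -/
theorem four_variance_le_sum_sqrt {ι : Type*} (s : Finset ι) (w : ι → ℝ)
    (hw : ∀ k ∈ s, 0 ≤ w k) (t : ι → DecisionTree N) (p : MvPolynomial (Fin N) ℝ)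
    (hp : ∀ x, evalBool p x = ∑ k ∈ s, w k * (if (t k).eval x = true then (1 : ℝ) else 0)) :
    4 * boolVariance p ≤
      ∑ j, Real.sqrt
        ((∑ k ∈ s, w k * (((Finset.univ.filter fun x : Fin N → Bool =>
            (t k).eval (update x j true) ≠ (t k).eval (update x j false)).card : ℝ) / (2 : ℝ) ^ N)) *
        (∑ k ∈ s, w k *
            (((Finset.univ.filter fun x : Fin N → Bool => j ∈ (t k).queries x).card : ℝ) / (2 : ℝ) ^ N)) *
        influence j p) := by
  classical
  have h2N : (0 : ℝ) < (2 : ℝ) ^ N := by positivity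
  set F : ι → (Fin N → Bool) → ℝ := fun k x => if (t k).eval x = true then (1 : ℝ) else 0 with hF
  set g := evalBool p with hgdef
  set S : Fin N → ℝ := fun j => (2 : ℝ) ^ N * influence j p with hSdef
  have hS : ∀ j, 0 ≤ S j := fun j => mul_nonneg h2N.le (influence_nonneg j p)
  have hg : ∀ j : Fin N, ∑ x, (g (update x j true) - g (update x j false)) ^ 2 ≤ S j := fun j =>
    (BooleanCorner.sum_sq_update_eq_influence p j).le
  -- names
  set c : ι → Fin N → ℝ := fun k j => ((Finset.univ.filter fun x : Fin N → Bool =>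
      (t k).eval (update x j true) ≠ (t k).eval (update x j false)).card : ℝ) with hc
  set q : ι → Fin N → ℝ := fun k j =>
      ((Finset.univ.filter fun x : Fin N → Bool => j ∈ (t k).queries x).card : ℝ) with hq
  set Ib : Fin N → ℝ := fun j => ∑ k ∈ s, w k * (c k j / (2 : ℝ) ^ N) with hIb
  set δb : Fin N → ℝ := fun j => ∑ k ∈ s, w k * (q k j / (2 : ℝ) ^ N) with hδb
  change 4 * boolVariance p ≤ ∑ j, Real.sqrt (Ib j * δb j * influence j p)
  -- linearity of the covariance in the first argument
  have hFk : ∀ x, ∑ k ∈ s, w k * F k x = g x := fun x => by rw [hp x]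
  have hPg : ∑ x, g x * g x = ∑ k ∈ s, w k * ∑ x, F k x * g x := by
    calc ∑ x, g x * g x = ∑ x, ∑ k ∈ s, w k * (F k x * g x) := by
          refine Finset.sum_congr rfl fun x _ => ?_
          rw [show g x * g x = (∑ k ∈ s, w k * F k x) * g x by rw [hFk x], Finset.sum_mul]
          exact Finset.sum_congr rfl fun k _ => by ring
      _ = ∑ k ∈ s, ∑ x, w k * (F k x * g x) := Finset.sum_comm
      _ = ∑ k ∈ s, w k * ∑ x, F k x * g x := Finset.sum_congr rfl fun k _ => by rw [Finset.mul_sum]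
  have hPs : ∑ x, g x = ∑ k ∈ s, w k * ∑ x, F k x := by
    calc ∑ x, g x = ∑ x, ∑ k ∈ s, w k * F k x := Finset.sum_congr rfl fun x _ => (hFk x).symm
      _ = ∑ k ∈ s, ∑ x, w k * F k x := Finset.sum_comm
      _ = ∑ k ∈ s, w k * ∑ x, F k x := Finset.sum_congr rfl fun k _ => by rw [Finset.mul_sum]
  have hlin : (2 : ℝ) ^ N * (∑ x, g x * g x) - (∑ x, g x) * (∑ x, g x)
      = ∑ k ∈ s, w k * ((2 : ℝ) ^ N * (∑ x, F k x * g x) - (∑ x, F k x) * (∑ x, g x)) := by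
    rw [hPg, show (∑ x, g x) * (∑ x, g x) = (∑ k ∈ s, w k * ∑ x, F k x) * (∑ x, g x) by rw [← hPs],
      Finset.mul_sum, Finset.sum_mul, ← Finset.sum_sub_distrib]
    exact Finset.sum_congr rfl fun k _ => by ring
  have hvar := BooleanCorner.sum_sq_sub_sq_sum_eq p
  rw [← hgdef] at hvar
  have hA : ∀ k j, ∑ x, (F k (update x j true) - F k (update x j false)) ^ 2 = c k j := fun k j =>
    sum_sq_update_eq_card (t k) (F k) (fun x => rfl) j
  -- the per-`λ` bound with `a_j = 4^N Ib_j`, `b_j = 4^N δb_j Inf_j`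
  have hbound : ∀ lam : Fin N → ℝ, (∀ j, 0 < lam j) → (2 : ℝ) ^ N * ((2 : ℝ) ^ N * boolVariance p) ≤
      (∑ j, (lam j * ((2 : ℝ) ^ N * ((2 : ℝ) ^ N * Ib j)) +
        ((2 : ℝ) ^ N * ((2 : ℝ) ^ N * (δb j * influence j p))) / lam j)) / 8 := by
    intro lam hl
    have h1 : (2 : ℝ) ^ N * ((2 : ℝ) ^ N * boolVariance p) ≤
        ∑ k ∈ s, w k * (((2 : ℝ) ^ N * (∑ j, lam j * c k j) + ∑ j, q k j * (S j / lam j)) / 8) := by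
      rw [← hvar, hlin]
      refine Finset.sum_le_sum fun k hk => mul_le_mul_of_nonneg_left ?_ (hw k hk)
      have := osss_wsens (t k) (F k) g S lam (fun x => rfl) hS hl hg
      simp only [hA k] at this
      exact this
    refine h1.trans (le_of_eq ?_)
    -- bookkeeping: both sides are `(Σ_k Σ_j w_k (2^N λ_j c_kj + q_kj S_j/λ_j)) / 8`
    have hL : ∑ k ∈ s, w k * (((2 : ℝ) ^ N * (∑ j, lam j * c k j) + ∑ j, q k j * (S j / lam j)) / 8) =
        (∑ k ∈ s, ∑ j, w k * ((2 : ℝ) ^ N * (lam j * c k j) + q k j * (S j / lam j))) / 8 := by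
      rw [Finset.sum_div]
      refine Finset.sum_congr rfl fun k _ => ?_
      rw [mul_div_assoc', mul_add, Finset.mul_sum, Finset.mul_sum, Finset.mul_sum, ← Finset.sum_add_distrib]
      congr 1
      refine Finset.sum_congr rfl fun j _ => ?_
      ring
    have hterm : ∀ j, lam j * ((2 : ℝ) ^ N * ((2 : ℝ) ^ N * Ib j)) +
        ((2 : ℝ) ^ N * ((2 : ℝ) ^ N * (δb j * influence j p))) / lam j =
        ∑ k ∈ s, w k * ((2 : ℝ) ^ N * (lam j * c k j) + q k j * (S j / lam j)) := by
      intro j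
      have hS' : S j = (2 : ℝ) ^ N * influence j p := rfl
      have hlj : lam j ≠ 0 := (hl j).ne'
      have hIbj : Ib j = ∑ k ∈ s, w k * (c k j / (2 : ℝ) ^ N) := rfl
      have hδbj : δb j = ∑ k ∈ s, w k * (q k j / (2 : ℝ) ^ N) := rfl
      rw [hIbj, hδbj, Finset.sum_mul, Finset.mul_sum, Finset.mul_sum, Finset.mul_sum, Finset.mul_sum, Finset.mul_sum,
        Finset.sum_div, ← Finset.sum_add_distrib]
      refine Finset.sum_congr rfl fun k _ => ?_
      rw [hS']
      field_simp
    have hR : (∑ j, (lam j * ((2 : ℝ) ^ N * ((2 : ℝ) ^ N * Ib j)) +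
        ((2 : ℝ) ^ N * ((2 : ℝ) ^ N * (δb j * influence j p))) / lam j)) =
        ∑ k ∈ s, ∑ j, w k * ((2 : ℝ) ^ N * (lam j * c k j) + q k j * (S j / lam j)) := by
      rw [Finset.sum_congr rfl fun j _ => hterm j, Finset.sum_comm]
    rw [hL, hR]
  have hIb0 : ∀ j, 0 ≤ Ib j := fun j => Finset.sum_nonneg fun k hk => mul_nonneg (hw k hk) (by positivity)
  have hδb0 : ∀ j, 0 ≤ δb j := fun j => Finset.sum_nonneg fun k hk => mul_nonneg (hw k hk) (by positivity)
  have ha : ∀ j, 0 ≤ (2 : ℝ) ^ N * ((2 : ℝ) ^ N * Ib j) := fun j => by have := hIb0 j; positivity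
  have hb : ∀ j, 0 ≤ (2 : ℝ) ^ N * ((2 : ℝ) ^ N * (δb j * influence j p)) := fun j => by
    have := hδb0 j; have := influence_nonneg j p; positivity
  have key := le_sum_sqrt_of_forall_pos _ _ ha hb hbound
  -- `√(4^N a · 4^N b) = 4^N √(ab)`; divide by `4^N`
  have hsq : ∀ j, Real.sqrt ((2 : ℝ) ^ N * ((2 : ℝ) ^ N * Ib j) * ((2 : ℝ) ^ N * ((2 : ℝ) ^ N * (δb j * influence j p))))
      = (2 : ℝ) ^ N * (2 : ℝ) ^ N * Real.sqrt (Ib j * δb j * influence j p) := by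
    intro j
    have h4 : 0 ≤ (2 : ℝ) ^ N * (2 : ℝ) ^ N := by positivity
    rw [show (2 : ℝ) ^ N * ((2 : ℝ) ^ N * Ib j) * ((2 : ℝ) ^ N * ((2 : ℝ) ^ N * (δb j * influence j p))) =
        ((2 : ℝ) ^ N * (2 : ℝ) ^ N) ^ 2 * (Ib j * δb j * influence j p) by ring,
      Real.sqrt_mul (by positivity), Real.sqrt_sq h4]
  simp only [hsq] at key
  rw [← Finset.mul_sum] at key
  have h4N : (0 : ℝ) < (2 : ℝ) ^ N * (2 : ℝ) ^ N := by positivity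
  have key' : ((2 : ℝ) ^ N * (2 : ℝ) ^ N) * (4 * boolVariance p) ≤
      ((2 : ℝ) ^ N * (2 : ℝ) ^ N) * ∑ j, Real.sqrt (Ib j * δb j * influence j p) := by
    have e1 : ((2 : ℝ) ^ N * (2 : ℝ) ^ N) * (4 * boolVariance p) = 4 * ((2 : ℝ) ^ N * ((2 : ℝ) ^ N * boolVariance p)) := by
      ring
    rw [e1]
    linarith
  exact le_of_mul_le_mul_left key' h4N

end ClassicalCornerSensitivityOSSS

end Summit.QuantumAdvantage.QuantumAdvantage.Theorems.SosSandwich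

end
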